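import Literature.MathematicalPhysics.QuantumFieldTheory.Balaban1983to89.B8CubeMemberBoxDomainsL0
import Literature.MathematicalPhysics.QuantumFieldTheory.Balaban1983to89.B8CubeMemberBoxRows
import Literature.MathematicalPhysics.QuantumFieldTheory.Balaban1983to89.B8Eq348CubeMemberKKT
import Literature.MathematicalPhysics.QuantumFieldTheory.Balaban1983to89.B6Ineq268MultiLevelBoxL0

/-!
# `Balaban1983to89.B8CubeMemberBoxRowsL0` — [Balaban1985RegularSpaces] (1.91) p. 91 ∕ [Balaban1984PropagatorsII] (2.13)–(2.14) p. 225: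
# THE CONSUMER'S DIRICHLET ROWS ON `□₀` ARE `η⁻²`·(p21's `Δ′_a` ROWS) AT THE LEVEL-`0` MEMBER `cubeDomainsL0` — EVERY SITE WITH ITS NEIGHBOURS IN `□₀`,
# LEVEL `0` INCLUDED — AND THE TOWER ∕ `Q′` DICTIONARY AT EVERY LEVEL

statement-level skeleton of published theorems with citation tags; proofs where landed; nothing here is a claim about the
Yang–Mills mass gap

`[Balaban1985RegularSpaces]` ("B8", CMP **99** (1985) 75–102) (1.91) p. 91 («G′ = (Δ + Q′*aQ′)⁻¹»), (1.131) p. 99, p. 98; `[Balaban1984PropagatorsII]` ("B6", CMP **96** (1984)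
223–250) (2.13)–(2.14) p. 225 («⟨λ, Q′*aQ′λ⟩ = Σ_{j=0}^{k} Σ_{y∈Λ_j} a_j(Lʲη)^{d−2}|(Q′_jλ)(y)|² … (Q′₀λ)(x) = λ(x), x ∈ Λ₀»), (2.69) p. 235.

CITATION HEADER (lean-in-tree rule).  Cell `pub-ymgap` (YM Track A, HUMAN RULING D-0062), DAG node N05 = [B8], seat `pub-ymgap-dag-n05-c` (g10; the (R1′) programme: the
𝒢-bound `B8Thm32GBoundCubeMember.GBoundCubeMemberPrinted`).  This file is the level-`0` twin of this base's F2 `B8CubeMemberBoxRows.row_eq_mlOp_row` (interior of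
`□₁`, member `cubeDomains` without level `0`) and F13 `B8CubeMemberBoxTowers` (tower dictionary), now for the WHOLE member `cubeDomainsL0` (file G1,
`B8CubeMemberBoxDomainsL0`): the consumer's explicit Dirichlet matrix `K` of `B8Prop6CubeMemberFlatScalar.prop6_cubeMember_flat_of_real` and p21's `mlOp` at the member
have THE SAME ROW at every site of `□₀` whose `2(d+1)` lattice neighbours lie in `□₀` — at level `0` the averaging term is the diagonal mass `a₀` («(Q′₀λ)(x) = λ(x)») —
and p21's block set `𝔅`, block map `blkOf`, normalised average `Q′ = QB` read at the translated towers of EVERY level are the consumer's towers and block averages.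
§5 transports products: `T·f` and `T²·f` at such sites are `η⁻²·(Δ′_a f̂)`, `η⁻⁴·(Δ′_a² f̂)` of the translated zero extension `f̂` (the second at sites whose
`2`-ball lies in `□₀`, by G0 `good_of_K_ne_zero`).  This is the input of the KKT transfer of the successor `B8Thm32GBoundCubeMemberHolds`.

WHAT THIS FILE PROVES (kernel-checked; `L = ℓ + 1`, cube datum `(a, M, ρ, k)`, truncation `1 ≤ n ≤ k`, F1's side conditions `M_hL ∣ ρ`, `M_hL ∣ M`, `R·M_hL ≤ ρ`,
`M_h ≥ 2`; weights `w_j·L^{−2(d+1)j} = η⁻²·levC d ℓ a j` for ALL `j ≤ n`, in particular `w₀ = η⁻²a₀`).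
* §1 `mlOp_row_sum` — a row of `mlOp` at an L0-family member applied to a box function (F2's lemma for the structure with `Λ₀`).
* §2 ★★ `row_eq_mlOp_row` — THE ROW DICTIONARY AT EVERY SITE OF `□₀` WITH NEIGHBOURS IN `□₀`: `Σ_{z∈□₀} K(x,z)g(z) = η⁻²·Σ_{y∈X} Δ′_a(x + t, y)·g(y − t)`.
* §3 towers: `blkOf_shift_val` (the p21 block of `x + t` is `(j, blk_{Lʲ}(x + t))` at the tower level `j` of `x ∈ □₀`, `j = 0` included), `blkOf_eq_shift_iff`,
  ★ `QB_translate` (`Q′` of a translated function at that block = the consumer's block average `L^{−(d+1)j}Σ_{Bʲ(z)=Bʲ(x)} g(z)`), `corner_blkOf_of_lev_zero`,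
  `blockMap_corner_sub_shift` (the corner of the block is in the consumer's tower), `exists_site_of_bset` (every p21 block is the block of a translated site; off
  `t + □₀` it has level `0`).
* §5 ★ `mulVec_transfer` (`(Tf)(x) = η⁻²(Δ′_a f̂)(x + t)` at sites with neighbours in `□₀`), ★★ `mulVec_mulVec_transfer` (`(T(Tf))(x) = η⁻⁴(Δ′_a(Δ′_a f̂))(x + t)` at
  sites whose `2`-ball lies in `□₀`).

HONEST SCOPE ∕ NOT CLAIMED.  Bookkeeping identities; no estimate.  The rows at the Dirichlet wall `∂□₀` (a neighbour outside `□₀`) are NOT related to the box (they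
differ: Dirichlet diagonal vs. Neumann row into `X ∖ (t + □₀)`) and are never used by the successor.  Count-neutral; N05 NOT discharged; one finite `T⁴` programme at
fixed `ε`, Bałaban as printed; nothing continuum ∕ ℝ⁴ ∕ OS ∕ mass-gap ∕ Clay.  No `sorry`, no `def`, no `instance`, no `notation`.  Unit `pub-ymgap-dag-n05-c` (g10), 2026-08-27.

RELATED IN THE TREE, NOT DUPLICATED: `B8CubeMemberBoxRows.{K_row_sum, mlOp_row_sum, row_eq_mlOp_row, pow_dvd_shift, blk_add_eq_iff, blockMap_eq_blk, add_shift_single}` (F2: the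
level-`≥ 1` structure and the interior of `□₁`; USED where structure-free), `B8CubeMemberBoxTowers.{blkOf_shift_val, blkOf_eq_shift_iff, QB_translate}` (F13: the same
dictionary for `cubeDomains`, whose `bset`∕`blkOf`∕`QB` are different objects), `B8CubeMemberBoxDomainsL0.*` (G1, USED), `B8Eq348CubeMemberKKT.good_of_K_ne_zero` (G0, USED),
`B6Ineq268MultiLevelBoxL0.{QB, QB_apply, W_eq, QsB_apply}`, `B6Geom246MultiLevelBoxL0.{bset, blkOf, corner, blkOf_corner}` (p21∕r03, USED), `B6MultiLevelBoxOperatorL0.mlOp_apply` (USED).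
-/
noncomputable section

namespace Literature.MathematicalPhysics.QuantumFieldTheory.Balaban1983to89.B8CubeMemberBoxRowsL0

open scoped Matrix
open B6MultiLevelBoxOperator (N0 bigSide mlOp levC)
open B4Reflection242 (boxDom mem_boxDom blk nbrs mem_nbrs neumannLapK avgK card_nbrs)
open B4Lemma24ZeroBoxAlphaNeg (blk_one)
open B7Prop1Local (InBox)
open B7Prop1Explicit (e)
open B8Eq131Cubes (cube)
open B8Eq131CubesAdmissible (cubeFam cubeFam_false_of_le)
open B8CubeMemberZd (cubeLamS)
open B8CubeMemberBoxDomains (shift boxP add_shift_sub_shift)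
open B8CubeMemberBoxDomainsL0 (levL0 levL0_le cubeDomainsL0 cubeDomainsL0_lev tower_iff_levL0_eq mem_boxDom_of_mem_cube_zero blockMap_pow_zero levL0_pos_iff
  levL0_shift_eq_zero_iff cube_one_subset_cube_zero)
open B8CubeMemberBoxRows (K_row_sum sum_nbrs_real pow_dvd_shift blk_add_eq_iff blockMap_eq_blk add_shift_single)
open B8Eq191FlatDirichletCoercive (towerBlock_subset_cube)
open B8Eq348CubeMemberKKT (good_of_K_ne_zero abs_e_apply_le)
open B6Geom246MultiLevelBoxL0 (bset blkOf blkOf_val blkOf_eq_iff_blk corner corner_mem blkOf_corner lev_eq_of_blkOf_eq exists_blkOf_eq)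
open B6Ineq268MultiLevelBoxL0 (W W_eq QB QB_apply)
open Literature.MathematicalPhysics.QuantumLattice (blockMap)

variable {d : ℕ}

/-! ## §1 A row of p21's `mlOp` at a member WITH `Λ₀` applied to a function on the box -/

/-- **A ROW OF `Δ′_a` APPLIED TO A FUNCTION** at an interior site `x̂` of the box (all `2(d+1)` neighbours in the box), for a member of the family WITH `Λ₀`:
`Σ_{y∈X} Δ′_a(x̂,y)G(y) = Σ_μ(2G(x̂) − G(x̂+e_μ) − G(x̂−e_μ)) + levC_{lev x̂}·Σ_{y∈X, B(y)=B(x̂)} G(y)` (at level `0`: `levC₀ = a₀` and the block is `{x̂}`).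
[cite: Balaban1984PropagatorsII, (2.13)–(2.14) p.225] -/
theorem mlOp_row_sum {ℓ Mh k R : ℕ} {P : Fin (d + 1) → ℕ} (D : B6MultiLevelBoxOperatorL0.Domains d ℓ Mh k P R) (aw : ℕ → ℝ)
    (xh : ↥(boxDom (N0 ℓ Mh k P))) (hnb : ∀ μ, xh.1 + Pi.single μ 1 ∈ boxDom (N0 ℓ Mh k P) ∧ xh.1 - Pi.single μ 1 ∈ boxDom (N0 ℓ Mh k P))
    (G : (Fin (d + 1) → ℤ) → ℝ) :
    ∑ y : ↥(boxDom (N0 ℓ Mh k P)), mlOp (N0 ℓ Mh k P) ℓ k D.lev aw xh y * G y.1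
      = ∑ μ : Fin (d + 1), (2 * G xh.1 - G (xh.1 + Pi.single μ 1) - G (xh.1 - Pi.single μ 1))
        + levC d ℓ aw (D.lev xh.1) * ∑ y ∈ (boxDom (N0 ℓ Mh k P)).filter
            (fun y => blk ((ℓ + 1) ^ D.lev xh.1) y = blk ((ℓ + 1) ^ D.lev xh.1) xh.1), G y := by
  classical
  simp_rw [B6MultiLevelBoxOperatorL0.mlOp_apply D rfl aw, add_mul, Finset.sum_add_distrib]
  rw [show (∑ y : ↥(boxDom (N0 ℓ Mh k P)), (neumannLapK (N0 ℓ Mh k P) xh.1 y.1 : ℝ) * G y.1)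
      = ∑ y ∈ boxDom (N0 ℓ Mh k P), (neumannLapK (N0 ℓ Mh k P) xh.1 y : ℝ) * G y from
      (Finset.sum_coe_sort (boxDom (N0 ℓ Mh k P)) (fun y => (neumannLapK (N0 ℓ Mh k P) xh.1 y : ℝ) * G y)),
    show (∑ y : ↥(boxDom (N0 ℓ Mh k P)), avgK (levC d ℓ aw (D.lev xh.1)) ((ℓ + 1) ^ D.lev xh.1) xh.1 y.1 * G y.1)
      = ∑ y ∈ boxDom (N0 ℓ Mh k P), avgK (levC d ℓ aw (D.lev xh.1)) ((ℓ + 1) ^ D.lev xh.1) xh.1 y * G y from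
      (Finset.sum_coe_sort (boxDom (N0 ℓ Mh k P)) (fun y => avgK (levC d ℓ aw (D.lev xh.1)) ((ℓ + 1) ^ D.lev xh.1) xh.1 y * G y))]
  congr 1
  · have hsub : nbrs xh.1 ⊆ boxDom (N0 ℓ Mh k P) := by
      intro z hz
      obtain ⟨μ, h | h⟩ := mem_nbrs.mp hz
      · rw [h]; exact (hnb μ).1
      · rw [h]; exact (hnb μ).2
    have hcard : ((nbrs xh.1).filter fun z => z ∈ boxDom (N0 ℓ Mh k P)).card = 2 * (d + 1) := by
      rw [Finset.filter_true_of_mem (fun z hz => hsub hz), card_nbrs]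
    have hpt : ∀ y ∈ boxDom (N0 ℓ Mh k P), (neumannLapK (N0 ℓ Mh k P) xh.1 y : ℝ) * G y
        = (if y = xh.1 then (2 * ((d : ℝ) + 1)) * G y else 0) - (if y ∈ nbrs xh.1 then G y else 0) := by
      intro y _
      unfold neumannLapK
      by_cases hy : y = xh.1
      · subst hy
        have hnot : xh.1 ∉ nbrs xh.1 := by
          intro h
          obtain ⟨μ, h | h⟩ := mem_nbrs.mp h <;>
          · have h2 := congrFun h μ
            simp at h2
            try linarith
        rw [if_pos rfl, if_pos rfl, if_neg hnot, hcard]; push_cast; ring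
      · rw [if_neg hy, if_neg hy]
        by_cases hyn : y ∈ nbrs xh.1
        · rw [if_pos hyn, if_pos hyn]; ring
        · rw [if_neg hyn, if_neg hyn]; ring
    rw [Finset.sum_congr rfl hpt, Finset.sum_sub_distrib, Finset.sum_ite_eq' _ xh.1, if_pos xh.2, ← Finset.sum_filter,
      Finset.filter_mem_eq_inter, Finset.inter_eq_right.mpr hsub, sum_nbrs_real]
    rw [Finset.sum_sub_distrib, Finset.sum_sub_distrib, Finset.sum_const, Finset.card_univ, Fintype.card_fin]
    simp only [nsmul_eq_mul]
    push_cast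
    ring
  · rw [Finset.mul_sum, Finset.sum_filter]
    refine Finset.sum_congr rfl fun y _ => ?_
    unfold avgK
    split_ifs <;> ring

/-! ## §2 THE ROW DICTIONARY at every site of `□₀` with neighbours in `□₀` -/

open Classical in
/-- **THE ROW DICTIONARY, LEVEL `0` INCLUDED.**  Let `K` be the explicit flat multi-level Dirichlet matrix of `prop6_cubeMember_flat_of_real` at truncation `n` (`L = ℓ + 1`,
restriction sets `cubeLamS … n`, weights `w` with `w_j·L^{−2(d+1)j} = η⁻²·levC d ℓ a j` for `j ≤ n`), `S = □₀`, and let `x ∈ □₀` have all its `2(d+1)` lattice neighbours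
in `□₀`.  Then for EVERY lattice function `g`: `Σ_{z∈□₀} K(x,z)·g(z) = η⁻²·Σ_{y∈X} Δ′_a(x + t, y)·g(y − t)`, `Δ′_a = mlOp` of p21 at the member `cubeDomainsL0`.  Both rows are
`η⁻²(−Δ)` on the neighbours plus ONE averaging term at the tower level `j(x) = levL0(x + t) ∈ {0, …, n}`, whose block translates onto the block of `x + t` (`Lʲ ∣ t`).
[cite: Balaban1985RegularSpaces, (1.91) p.91, (1.131) p.99, p.98; Balaban1984PropagatorsII, (2.13)–(2.14) p.225, (2.1)–(2.4) p.224] -/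
theorem row_eq_mlOp_row {ℓ Mh : ℕ} (hℓ : 1 ≤ ℓ) (hMh : 1 ≤ Mh) (hMh2 : 2 ≤ Mh) (a : Fin (d + 1) → ℤ) {M ρ k n R : ℕ} (hn : 1 ≤ n) (hnk : n ≤ k)
    (hρd : Mh * (ℓ + 1) ∣ ρ) (hMd : Mh * (ℓ + 1) ∣ M) (hρ0 : 0 < ρ) (hR : R * (Mh * (ℓ + 1)) ≤ ρ)
    {η : ℝ} (w aw : ℕ → ℝ)
    (hw : ∀ j, j ≤ n → w j * (((((ℓ + 1 : ℕ) : ℝ) ^ (d + 1))⁻¹) ^ j) ^ 2 = (η ^ 2)⁻¹ * levC d ℓ aw j)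
    (K : (Fin (d + 1) → ℤ) → (Fin (d + 1) → ℤ) → ℝ)
    (hK : ∀ x z, K x z = ((η ^ 2)⁻¹ * ∑ μ : Fin (d + 1), ((2 : ℝ) * (if z = x then (1 : ℝ) else 0) - (if z = x + e μ then (1 : ℝ) else 0)
        - (if z = x - e μ then (1 : ℝ) else 0))) +
        (∑ j ∈ Finset.range (n + 1), (if blockMap ((ℓ + 1) ^ j) x ∈ cubeLamS (ℓ + 1) a M ρ k n j ∧
            blockMap ((ℓ + 1) ^ j) z = blockMap ((ℓ + 1) ^ j) x then
          w j * (((((ℓ + 1 : ℕ) : ℝ) ^ (d + 1))⁻¹) ^ j) ^ 2 else 0)))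
    (S : Finset (Fin (d + 1) → ℤ)) (hS : ∀ z, z ∈ S ↔ z ∈ cubeFam false (ℓ + 1) a M ρ k 0)
    (y : ↥(boxDom (N0 ℓ Mh n (boxP ℓ M ρ k n)))) {x : Fin (d + 1) → ℤ} (hyx : y.1 = x + shift ℓ Mh a ρ k n)
    (hx : x ∈ cube (ℓ + 1) a M ρ k 0) (hxe : ∀ μ, x + e μ ∈ cube (ℓ + 1) a M ρ k 0 ∧ x - e μ ∈ cube (ℓ + 1) a M ρ k 0)
    (g : (Fin (d + 1) → ℤ) → ℝ) :
    ∑ z ∈ S, K x z * g z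
      = (η ^ 2)⁻¹ * ∑ y' : ↥(boxDom (N0 ℓ Mh n (boxP ℓ M ρ k n))),
          mlOp (N0 ℓ Mh n (boxP ℓ M ρ k n)) ℓ n (levL0 ℓ Mh a M ρ k n) aw y y' * g (y'.1 - shift ℓ Mh a ρ k n) := by
  have hL : 1 ≤ ℓ + 1 := Nat.succ_pos ℓ
  have hk : 1 ≤ k := hn.trans hnk
  have hρL : ℓ + 1 ≤ ρ := le_trans (Nat.le_mul_of_pos_left _ hMh) (Nat.le_of_dvd hρ0 hρd)
  set t := shift ℓ Mh a ρ k n with ht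
  set D := cubeDomainsL0 hMh a hn hnk hρd hMd hρ0 hR with hD
  have h00 : cube (ℓ + 1) a M ρ k 0 = cubeFam false (ℓ + 1) a M ρ k 0 := (cubeFam_false_of_le _ a M ρ (Nat.zero_le k)).symm
  have hxS : x ∈ S := (hS x).mpr (by rw [← h00]; exact hx)
  have hxeS : ∀ μ, x + e μ ∈ S ∧ x - e μ ∈ S := fun μ =>
    ⟨(hS _).mpr (by rw [← h00]; exact (hxe μ).1), (hS _).mpr (by rw [← h00]; exact (hxe μ).2)⟩
  -- the consumer's row
  rw [K_row_sum (ℓ + 1) n (cubeLamS (ℓ + 1) a M ρ k n) w K (by simpa using hK) S hxS hxeS g]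
  -- p21's row at `y`, read through the member
  have hnb : ∀ μ, y.1 + Pi.single μ 1 ∈ boxDom (N0 ℓ Mh n (boxP ℓ M ρ k n)) ∧
      y.1 - Pi.single μ 1 ∈ boxDom (N0 ℓ Mh n (boxP ℓ M ρ k n)) := by
    intro μ
    obtain ⟨h1, h2⟩ := add_shift_single t x μ
    rw [hyx]
    refine ⟨?_, ?_⟩
    · rw [h1]; exact mem_boxDom_of_mem_cube_zero hℓ hMh2 a hn hnk (hxe μ).1
    · rw [h2]; exact mem_boxDom_of_mem_cube_zero hℓ hMh2 a hn hnk (hxe μ).2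
  have hrow := mlOp_row_sum D aw y hnb (fun z => g (z - t))
  rw [show (levL0 ℓ Mh a M ρ k n) = D.lev from rfl, hrow]
  -- the Laplacian parts agree after translating back
  obtain hj := fun μ => add_shift_single t x μ
  have hlap : ∑ μ : Fin (d + 1), (2 * g (y.1 - t) - g (y.1 + Pi.single μ 1 - t) - g (y.1 - Pi.single μ 1 - t))
      = ∑ μ : Fin (d + 1), (2 * g x - g (x + e μ) - g (x - e μ)) := by
    refine Finset.sum_congr rfl fun μ _ => ?_
    rw [hyx, (hj μ).1, (hj μ).2]
    simp only [ht, add_shift_sub_shift]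
  rw [hlap, mul_add]
  congr 1
  -- the averaging parts: the sum over levels collapses to the tower level `j₀ = levL0 (x + t)`
  set j₀ := D.lev y.1 with hj₀
  have hj₀' : levL0 ℓ Mh a M ρ k n (x + t) = j₀ := by rw [hj₀, hyx]; rfl
  have hj₀n : j₀ ≤ n := by rw [← hj₀']; exact levL0_le ℓ Mh a M ρ k hn _
  have hcollapse : ∀ j ∈ Finset.range (n + 1),
      (if blockMap ((ℓ + 1) ^ j) x ∈ cubeLamS (ℓ + 1) a M ρ k n j then
        w j * (((((ℓ + 1 : ℕ) : ℝ) ^ (d + 1))⁻¹) ^ j) ^ 2 *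
          ∑ z ∈ S.filter (fun z => blockMap ((ℓ + 1) ^ j) z = blockMap ((ℓ + 1) ^ j) x), g z else 0)
      = if j₀ = j then w j * (((((ℓ + 1 : ℕ) : ℝ) ^ (d + 1))⁻¹) ^ j) ^ 2 *
          ∑ z ∈ S.filter (fun z => blockMap ((ℓ + 1) ^ j) z = blockMap ((ℓ + 1) ^ j) x), g z else 0 := by
    intro j hj
    have hjn : j ≤ n := Nat.lt_succ_iff.mp (Finset.mem_range.mp hj)
    have hiff := tower_iff_levL0_eq a M hρL hn hnk hjn hx (Mh := Mh)
    rw [hj₀'] at hiff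
    by_cases h : blockMap ((ℓ + 1) ^ j) x ∈ cubeLamS (ℓ + 1) a M ρ k n j
    · rw [if_pos h, if_pos (hiff.mp h)]
    · rw [if_neg h, if_neg (fun h' => h (hiff.mpr h'))]
  rw [Finset.sum_congr rfl hcollapse, Finset.sum_ite_eq, if_pos (Finset.mem_range.mpr (Nat.lt_succ_of_le hj₀n))]
  -- `x` is at tower level `j₀`
  have htower : blockMap ((ℓ + 1) ^ j₀) x ∈ cubeLamS (ℓ + 1) a M ρ k n j₀ :=
    (tower_iff_levL0_eq a M hρL hn hnk hj₀n hx (Mh := Mh)).mpr hj₀'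
  -- the block sums agree under `z ↦ z + t` (`L^{j₀} ∣ t`)
  have hdvd : ∀ i, (((ℓ + 1) ^ j₀ : ℕ) : ℤ) ∣ t i := fun i => by
    have := pow_dvd_shift ℓ Mh a ρ hj₀n hnk i (d := d)
    push_cast at this ⊢; exact this
  have hb : 1 ≤ (ℓ + 1) ^ j₀ := Nat.one_le_pow _ _ hL
  have hyt : y.1 = x + t := hyx
  have hblocks : (∑ z ∈ S.filter (fun z => blockMap ((ℓ + 1) ^ j₀) z = blockMap ((ℓ + 1) ^ j₀) x), g z)
      = ∑ y' ∈ (boxDom (N0 ℓ Mh n (boxP ℓ M ρ k n))).filter (fun y' => blk ((ℓ + 1) ^ j₀) y' = blk ((ℓ + 1) ^ j₀) y.1),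
          g (y' - t) := by
    refine Finset.sum_nbij' (fun z => z + t) (fun y' => y' - t) ?_ ?_ ?_ ?_ ?_
    · intro z hz
      rw [Finset.mem_filter] at hz ⊢
      obtain ⟨hzS, hzq⟩ := hz
      have hzq' : blk ((ℓ + 1) ^ j₀) z = blk ((ℓ + 1) ^ j₀) x := by rw [← blockMap_eq_blk, ← blockMap_eq_blk]; exact hzq
      have hz0 : z ∈ cube (ℓ + 1) a M ρ k 0 := by
        rw [h00]; exact towerBlock_subset_cube hL a M hρL hnk hj₀n htower hzq
      refine ⟨mem_boxDom_of_mem_cube_zero hℓ hMh2 a hn hnk hz0, ?_⟩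
      rw [hyt]; exact (blk_add_eq_iff hb hdvd z x).mpr hzq'
    · intro y' hy'
      rw [Finset.mem_filter] at hy' ⊢
      obtain ⟨hyb, hyq⟩ := hy'
      have hq : blk ((ℓ + 1) ^ j₀) (y' - t) = blk ((ℓ + 1) ^ j₀) x := by
        rw [← blk_add_eq_iff hb hdvd (y' - t) x, sub_add_cancel, ← hyt]; exact hyq
      refine ⟨(hS _).mpr ?_, ?_⟩
      · exact towerBlock_subset_cube hL a M hρL hnk hj₀n htower (by rw [blockMap_eq_blk]; exact hq)
      · rw [blockMap_eq_blk, blockMap_eq_blk]; exact hq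
    · intro z _; exact add_sub_cancel_right z t
    · intro y' _; exact sub_add_cancel y' t
    · intro z _; rw [add_sub_cancel_right]
  rw [hblocks, ← mul_assoc, hw j₀ hj₀n, mul_assoc]

/-! ## §3 The tower dictionary at every level -/

/-- **THE p21 BLOCK OF A TRANSLATED SITE OF `□₀`**: for `x ∈ □₀` with tower `(j, Bʲ(x))` (`Bʲ(x) ∈ Λs_j`, `j ≤ n`, `j = 0` admitted) and a box site `y = x + t`, the block
`blkOf` of `y` in the member `cubeDomainsL0` is `(j, blk_{Lʲ}(y))`. [cite: Balaban1984PropagatorsII, (2.1)–(2.4) p.224, (2.45) p.231; Balaban1985RegularSpaces, (1.31) p.81, (1.131) p.99] -/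
theorem blkOf_shift_val {ℓ Mh : ℕ} (hMh : 1 ≤ Mh) (a : Fin (d + 1) → ℤ) {M ρ k n R : ℕ} (hn : 1 ≤ n) (hnk : n ≤ k)
    (hρd : Mh * (ℓ + 1) ∣ ρ) (hMd : Mh * (ℓ + 1) ∣ M) (hρ0 : 0 < ρ) (hR : R * (Mh * (ℓ + 1)) ≤ ρ)
    (y : ↥(boxDom (N0 ℓ Mh n (boxP ℓ M ρ k n)))) {x : Fin (d + 1) → ℤ} (hyx : y.1 = x + shift ℓ Mh a ρ k n)
    (hx0 : x ∈ cube (ℓ + 1) a M ρ k 0) {j : ℕ} (hjn : j ≤ n) (hxj : blockMap ((ℓ + 1) ^ j) x ∈ cubeLamS (ℓ + 1) a M ρ k n j) :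
    (blkOf (cubeDomainsL0 hMh a hn hnk hρd hMd hρ0 hR) y).1 = (j, blk ((ℓ + 1) ^ j) y.1) := by
  have hρL : ℓ + 1 ≤ ρ := le_trans (Nat.le_mul_of_pos_left _ hMh) (Nat.le_of_dvd hρ0 hρd)
  have hlev : levL0 ℓ Mh a M ρ k n y.1 = j := by
    rw [hyx]; exact (tower_iff_levL0_eq a M hρL hn hnk hjn hx0 (Mh := Mh)).mp hxj
  rw [blkOf_val]
  change (levL0 ℓ Mh a M ρ k n y.1, blk ((ℓ + 1) ^ levL0 ℓ Mh a M ρ k n y.1) y.1) = (j, blk ((ℓ + 1) ^ j) y.1)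
  rw [hlev]

/-- **THE SITES OF THAT p21 BLOCK ARE THE TRANSLATED SITES OF THE CONSUMER'S TOWER BLOCK**: with `x, y, j` as above and any box site `y′`,
`blkOf y′ = blkOf y ⇔ Bʲ(y′ − t) = Bʲ(x)` (`Lʲ ∣ t`). [cite: Balaban1984PropagatorsII, (2.1)–(2.4) p.224, (2.45) p.231; Balaban1985RegularSpaces, (1.31) p.81, p.79] -/
theorem blkOf_eq_shift_iff {ℓ Mh : ℕ} (hMh : 1 ≤ Mh) (a : Fin (d + 1) → ℤ) {M ρ k n R : ℕ} (hn : 1 ≤ n) (hnk : n ≤ k)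
    (hρd : Mh * (ℓ + 1) ∣ ρ) (hMd : Mh * (ℓ + 1) ∣ M) (hρ0 : 0 < ρ) (hR : R * (Mh * (ℓ + 1)) ≤ ρ)
    (y : ↥(boxDom (N0 ℓ Mh n (boxP ℓ M ρ k n)))) {x : Fin (d + 1) → ℤ} (hyx : y.1 = x + shift ℓ Mh a ρ k n)
    (hx0 : x ∈ cube (ℓ + 1) a M ρ k 0) {j : ℕ} (hjn : j ≤ n) (hxj : blockMap ((ℓ + 1) ^ j) x ∈ cubeLamS (ℓ + 1) a M ρ k n j)
    (y' : ↥(boxDom (N0 ℓ Mh n (boxP ℓ M ρ k n)))) :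
    blkOf (cubeDomainsL0 hMh a hn hnk hρd hMd hρ0 hR) y' = blkOf (cubeDomainsL0 hMh a hn hnk hρd hMd hρ0 hR) y
      ↔ blockMap ((ℓ + 1) ^ j) (y'.1 - shift ℓ Mh a ρ k n) = blockMap ((ℓ + 1) ^ j) x := by
  have hL : 1 ≤ ℓ + 1 := Nat.succ_pos ℓ
  have hLj : 1 ≤ (ℓ + 1) ^ j := Nat.one_le_pow _ _ hL
  have hdvd : ∀ i, (((ℓ + 1) ^ j : ℕ) : ℤ) ∣ shift ℓ Mh a ρ k n i := fun i => pow_dvd_shift ℓ Mh a ρ hjn hnk i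
  have hval := blkOf_shift_val hMh a hn hnk hρd hMd hρ0 hR y hyx hx0 hjn hxj
  rw [blkOf_eq_iff_blk]
  have h1 : (blkOf (cubeDomainsL0 hMh a hn hnk hρd hMd hρ0 hR) y).1.1 = j := by rw [hval]
  have h2 : (blkOf (cubeDomainsL0 hMh a hn hnk hρd hMd hρ0 hR) y).1.2 = blk ((ℓ + 1) ^ j) y.1 := by rw [hval]
  rw [h1, h2, hyx]
  have hy' : y'.1 = (y'.1 - shift ℓ Mh a ρ k n) + shift ℓ Mh a ρ k n := (sub_add_cancel _ _).symm
  conv_lhs => rw [hy']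
  rw [blk_add_eq_iff hLj hdvd, blockMap_eq_blk, blockMap_eq_blk]

open Classical in
/-- **`Q′` OF A TRANSLATED FUNCTION = THE CONSUMER'S BLOCK AVERAGE, AT EVERY LEVEL**: for `x ∈ □₀` with tower `(j, Bʲ(x))`, `y = x + t` and `g` on the lattice,
`(Q′(g(· − t)))(blkOf y) = L^{−(d+1)j}·Σ_{z ∈ □₀, Bʲ(z) = Bʲ(x)} g(z)` — p21's `QB` on the member `cubeDomainsL0` read at the cube member (at `j = 0`: `g(x)`).
[cite: Balaban1984PropagatorsII, (2.14)–(2.15) p.225, (2.69) p.235; Balaban1985RegularSpaces, (1.31) p.81, p.91 (the operator `Q′`)] -/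
theorem QB_translate {ℓ Mh : ℕ} (hℓ : 1 ≤ ℓ) (hMh : 1 ≤ Mh) (hMh2 : 2 ≤ Mh) (a : Fin (d + 1) → ℤ) {M ρ k n R : ℕ} (hn : 1 ≤ n) (hnk : n ≤ k)
    (hρd : Mh * (ℓ + 1) ∣ ρ) (hMd : Mh * (ℓ + 1) ∣ M) (hρ0 : 0 < ρ) (hR : R * (Mh * (ℓ + 1)) ≤ ρ)
    (S : Finset (Fin (d + 1) → ℤ)) (hS : ∀ z, z ∈ S ↔ z ∈ cubeFam false (ℓ + 1) a M ρ k 0)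
    (y : ↥(boxDom (N0 ℓ Mh n (boxP ℓ M ρ k n)))) {x : Fin (d + 1) → ℤ} (hyx : y.1 = x + shift ℓ Mh a ρ k n)
    (hx0 : x ∈ cube (ℓ + 1) a M ρ k 0) {j : ℕ} (hjn : j ≤ n) (hxj : blockMap ((ℓ + 1) ^ j) x ∈ cubeLamS (ℓ + 1) a M ρ k n j)
    (g : (Fin (d + 1) → ℤ) → ℝ) :
    QB (cubeDomainsL0 hMh a hn hnk hρd hMd hρ0 hR) (fun y' => g (y'.1 - shift ℓ Mh a ρ k n))
        (blkOf (cubeDomainsL0 hMh a hn hnk hρd hMd hρ0 hR) y)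
      = (((((ℓ : ℝ) + 1) ^ j) ^ (d + 1)))⁻¹ * ∑ z ∈ S.filter (fun z => blockMap ((ℓ + 1) ^ j) z = blockMap ((ℓ + 1) ^ j) x), g z := by
  have hL : 1 ≤ ℓ + 1 := Nat.succ_pos ℓ
  have hρL : ℓ + 1 ≤ ρ := le_trans (Nat.le_mul_of_pos_left _ hMh) (Nat.le_of_dvd hρ0 hρd)
  have h00 : cube (ℓ + 1) a M ρ k 0 = cubeFam false (ℓ + 1) a M ρ k 0 := (cubeFam_false_of_le _ a M ρ (Nat.zero_le k)).symm
  set D := cubeDomainsL0 hMh a hn hnk hρd hMd hρ0 hR with hD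
  set s₀ := blkOf D y with hs₀
  have hval : s₀.1 = (j, blk ((ℓ + 1) ^ j) y.1) := blkOf_shift_val hMh a hn hnk hρd hMd hρ0 hR y hyx hx0 hjn hxj
  rw [QB_apply, W_eq, show s₀.1.1 = j by rw [hval]]
  congr 1
  -- the bijection `y′ ↦ y′ − t` between the sites of the p21 block and the sites of the consumer's tower block
  have hmem0 : ∀ z, blockMap ((ℓ + 1) ^ j) z = blockMap ((ℓ + 1) ^ j) x → z ∈ cube (ℓ + 1) a M ρ k 0 := fun z hz => by
    rw [h00]; exact towerBlock_subset_cube hL a M hρL hnk hjn hxj hz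
  have hmemS : ∀ z, blockMap ((ℓ + 1) ^ j) z = blockMap ((ℓ + 1) ^ j) x → z ∈ S := fun z hz =>
    (hS z).mpr (towerBlock_subset_cube hL a M hρL hnk hjn hxj hz)
  symm
  refine Finset.sum_nbij' (fun z => if h : z + shift ℓ Mh a ρ k n ∈ boxDom (N0 ℓ Mh n (boxP ℓ M ρ k n)) then ⟨z + shift ℓ Mh a ρ k n, h⟩ else y)
    (fun y' => y'.1 - shift ℓ Mh a ρ k n) ?_ ?_ ?_ ?_ ?_
  · -- into the p21 block
    intro z hz
    have hzb := (Finset.mem_filter.mp hz).2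
    have hbox : z + shift ℓ Mh a ρ k n ∈ boxDom (N0 ℓ Mh n (boxP ℓ M ρ k n)) := mem_boxDom_of_mem_cube_zero hℓ hMh2 a hn hnk (hmem0 z hzb)
    rw [dif_pos hbox, Finset.mem_filter]
    refine ⟨Finset.mem_univ _, ?_⟩
    rw [hs₀, blkOf_eq_shift_iff hMh a hn hnk hρd hMd hρ0 hR y hyx hx0 hjn hxj]
    change blockMap ((ℓ + 1) ^ j) (z + shift ℓ Mh a ρ k n - shift ℓ Mh a ρ k n) = blockMap ((ℓ + 1) ^ j) x
    rw [add_sub_cancel_right]; exact hzb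
  · -- onto the consumer block
    intro y' hy'
    have hb := (Finset.mem_filter.mp hy').2
    rw [hs₀, blkOf_eq_shift_iff hMh a hn hnk hρd hMd hρ0 hR y hyx hx0 hjn hxj] at hb
    exact Finset.mem_filter.mpr ⟨hmemS _ hb, hb⟩
  · -- left inverse
    intro z hz
    have hzb := (Finset.mem_filter.mp hz).2
    have hbox : z + shift ℓ Mh a ρ k n ∈ boxDom (N0 ℓ Mh n (boxP ℓ M ρ k n)) := mem_boxDom_of_mem_cube_zero hℓ hMh2 a hn hnk (hmem0 z hzb)
    rw [dif_pos hbox]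
    exact add_sub_cancel_right _ _
  · -- right inverse
    intro y' hy'
    have hbox : y'.1 - shift ℓ Mh a ρ k n + shift ℓ Mh a ρ k n ∈ boxDom (N0 ℓ Mh n (boxP ℓ M ρ k n)) := by rw [sub_add_cancel]; exact y'.2
    rw [dif_pos hbox]
    exact Subtype.ext (sub_add_cancel _ _)
  · -- the summands agree
    intro z hz
    have hzb := (Finset.mem_filter.mp hz).2
    have hbox : z + shift ℓ Mh a ρ k n ∈ boxDom (N0 ℓ Mh n (boxP ℓ M ρ k n)) := mem_boxDom_of_mem_cube_zero hℓ hMh2 a hn hnk (hmem0 z hzb)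
    rw [dif_pos hbox]
    change g z = g (z + shift ℓ Mh a ρ k n - shift ℓ Mh a ρ k n)
    rw [add_sub_cancel_right]

/-- **AT LEVEL `0` THE CORNER OF THE BLOCK IS THE SITE** (`B⁰(Λ₀) = Λ₀`: the level-`0` block of `y` is `{y}`). [cite: Balaban1984PropagatorsII, (2.4) p.224 («B⁰(Λ₀) = Λ₀»), (2.45) p.231] -/
theorem corner_blkOf_of_lev_zero {ℓ Mh k R : ℕ} {P : Fin (d + 1) → ℕ} (D : B6MultiLevelBoxOperatorL0.Domains d ℓ Mh k P R)
    (y : ↥(boxDom (N0 ℓ Mh k P))) (h0 : D.lev y.1 = 0) : corner D (blkOf D y) = y.1 := by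
  funext μ
  unfold corner
  rw [blkOf_val]
  change (((ℓ + 1) ^ D.lev y.1 : ℕ) : ℤ) * blk ((ℓ + 1) ^ D.lev y.1) y.1 μ = y.1 μ
  rw [h0, pow_zero, blk_one, Nat.cast_one, one_mul]

/-- A block of level `0` is the block of its corner, a level-`0` site: `{x : blkOf x = s} = {corner s}` read pointwise. [cite: Balaban1984PropagatorsII, (2.4) p.224 («B⁰(Λ₀) = Λ₀»), (2.45) p.231] -/
theorem eq_corner_of_blkOf_eq_of_level_zero {ℓ Mh k R : ℕ} {P : Fin (d + 1) → ℕ} (D : B6MultiLevelBoxOperatorL0.Domains d ℓ Mh k P R)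
    {s : ↥(bset D)} (hs : s.1.1 = 0) (y : ↥(boxDom (N0 ℓ Mh k P))) (hy : blkOf D y = s) : y.1 = corner D s := by
  have hlev : D.lev y.1 = 0 := (lev_eq_of_blkOf_eq D hy).trans hs
  rw [← hy, corner_blkOf_of_lev_zero D y hlev]

/-- **`Q′` AT A LEVEL-`0` BLOCK IS THE POINT EVALUATION AT ITS CORNER** («(Q′₀λ)(x) = λ(x), x ∈ Λ₀»). [cite: Balaban1984PropagatorsII, (2.14) p.225, (2.4) p.224] -/
theorem QB_level_zero {ℓ Mh k R : ℕ} {P : Fin (d + 1) → ℕ} (D : B6MultiLevelBoxOperatorL0.Domains d ℓ Mh k P R)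
    (f : ↥(boxDom (N0 ℓ Mh k P)) → ℝ) (s : ↥(bset D)) (hs : s.1.1 = 0) :
    QB D f s = f ⟨corner D s, corner_mem D s⟩ := by
  classical
  rw [QB_apply, W_eq, hs, pow_zero, one_pow, inv_one, one_mul]
  rw [Finset.sum_eq_single ⟨corner D s, corner_mem D s⟩]
  · intro y hy hne
    exact absurd (Subtype.ext (eq_corner_of_blkOf_eq_of_level_zero D hs y (Finset.mem_filter.mp hy).2)) hne
  · intro h
    exfalso
    exact h (Finset.mem_filter.mpr ⟨Finset.mem_univ _, blkOf_corner D s⟩)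

/-- **THE CORNER OF THE p21 BLOCK OF `x + t` LIES IN THE CONSUMER'S TOWER OF `x`**: `Bʲ(corner(blkOf(x + t)) − t) = Bʲ(x)`. [cite: Balaban1984PropagatorsII, (2.1) p.224, (2.45) p.231; Balaban1985RegularSpaces, (1.31) p.81] -/
theorem blockMap_corner_sub_shift {ℓ Mh : ℕ} (hMh : 1 ≤ Mh) (a : Fin (d + 1) → ℤ) {M ρ k n R : ℕ} (hn : 1 ≤ n) (hnk : n ≤ k)
    (hρd : Mh * (ℓ + 1) ∣ ρ) (hMd : Mh * (ℓ + 1) ∣ M) (hρ0 : 0 < ρ) (hR : R * (Mh * (ℓ + 1)) ≤ ρ)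
    (y : ↥(boxDom (N0 ℓ Mh n (boxP ℓ M ρ k n)))) {x : Fin (d + 1) → ℤ} (hyx : y.1 = x + shift ℓ Mh a ρ k n)
    (hx0 : x ∈ cube (ℓ + 1) a M ρ k 0) {j : ℕ} (hjn : j ≤ n) (hxj : blockMap ((ℓ + 1) ^ j) x ∈ cubeLamS (ℓ + 1) a M ρ k n j) :
    blockMap ((ℓ + 1) ^ j) (corner (cubeDomainsL0 hMh a hn hnk hρd hMd hρ0 hR) (blkOf (cubeDomainsL0 hMh a hn hnk hρd hMd hρ0 hR) y) - shift ℓ Mh a ρ k n)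
      = blockMap ((ℓ + 1) ^ j) x := by
  have h := blkOf_corner (cubeDomainsL0 hMh a hn hnk hρd hMd hρ0 hR) (blkOf (cubeDomainsL0 hMh a hn hnk hρd hMd hρ0 hR) y)
  exact (blkOf_eq_shift_iff hMh a hn hnk hρd hMd hρ0 hR y hyx hx0 hjn hxj ⟨_, corner_mem _ _⟩).mp h

/-- **EVERY p21 BLOCK OF POSITIVE LEVEL IS THE BLOCK OF A TRANSLATED TOWER SITE OF `□₁`**: for `s ∈ 𝔅` with `1 ≤ level(s)` there is `x ∈ □₁` (so `x ∈ □₀`) in the consumer's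
tower `(level(s), B(x))` with `blkOf (x + t) = s`. [cite: Balaban1984PropagatorsII, (2.1)–(2.4) p.224, (2.45) p.231; Balaban1985RegularSpaces, (1.131) p.99] -/
theorem exists_site_of_pos_level {ℓ Mh : ℕ} (hMh : 1 ≤ Mh) (a : Fin (d + 1) → ℤ) {M ρ k n R : ℕ} (hn : 1 ≤ n) (hnk : n ≤ k)
    (hρd : Mh * (ℓ + 1) ∣ ρ) (hMd : Mh * (ℓ + 1) ∣ M) (hρ0 : 0 < ρ) (hR : R * (Mh * (ℓ + 1)) ≤ ρ)
    (s : ↥(bset (cubeDomainsL0 hMh a hn hnk hρd hMd hρ0 hR))) (hs : 1 ≤ s.1.1) :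
    ∃ (y : ↥(boxDom (N0 ℓ Mh n (boxP ℓ M ρ k n)))) (x : Fin (d + 1) → ℤ), y.1 = x + shift ℓ Mh a ρ k n ∧ x ∈ cube (ℓ + 1) a M ρ k 1 ∧
      x ∈ cube (ℓ + 1) a M ρ k 0 ∧ s.1.1 ≤ n ∧ blockMap ((ℓ + 1) ^ s.1.1) x ∈ cubeLamS (ℓ + 1) a M ρ k n s.1.1 ∧
      blkOf (cubeDomainsL0 hMh a hn hnk hρd hMd hρ0 hR) y = s := by
  have hρL : ℓ + 1 ≤ ρ := le_trans (Nat.le_mul_of_pos_left _ hMh) (Nat.le_of_dvd hρ0 hρd)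
  have hk : 1 ≤ k := hn.trans hnk
  obtain ⟨y, hy⟩ := exists_blkOf_eq (cubeDomainsL0 hMh a hn hnk hρd hMd hρ0 hR) s
  have hlev : levL0 ℓ Mh a M ρ k n y.1 = s.1.1 := lev_eq_of_blkOf_eq (cubeDomainsL0 hMh a hn hnk hρd hMd hρ0 hR) hy
  set x := y.1 - shift ℓ Mh a ρ k n with hx
  have hyx : y.1 = x + shift ℓ Mh a ρ k n := (sub_add_cancel _ _).symm
  have hx1 : x ∈ cube (ℓ + 1) a M ρ k 1 := by
    have h := (levL0_pos_iff a M hρL hn hnk y.1 (Mh := Mh)).mp (by rw [hlev]; exact hs)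
    exact h
  have hx0 : x ∈ cube (ℓ + 1) a M ρ k 0 := cube_one_subset_cube_zero a M hρL hk hx1
  have hsn : s.1.1 ≤ n := by rw [← hlev]; exact levL0_le ℓ Mh a M ρ k hn _
  have htower : blockMap ((ℓ + 1) ^ s.1.1) x ∈ cubeLamS (ℓ + 1) a M ρ k n s.1.1 := by
    refine (tower_iff_levL0_eq a M hρL hn hnk hsn hx0 (Mh := Mh)).mpr ?_
    rw [← hyx]; exact hlev
  exact ⟨y, x, hyx, hx1, hx0, hsn, htower, hy⟩

/-! ## §5 Products transported: `T·f` and `T²·f` at deep sites are `η⁻²Δ′_a f̂`, `η⁻⁴Δ′_a²f̂` of the translated zero extension -/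

open Classical in
/-- **`(Tf)(x) = η⁻²·(Δ′_a f̂)(x + t)`** at every `x ∈ □₀` with its neighbours in `□₀`, where `f̂(y) = f(y − t)` on `t + □₀` and `0` elsewhere (the zero extension translated).
[cite: Balaban1985RegularSpaces, (1.91) p.91; Balaban1984PropagatorsII, (2.13)–(2.14) p.225] -/
theorem mulVec_transfer {ℓ Mh : ℕ} (hℓ : 1 ≤ ℓ) (hMh : 1 ≤ Mh) (hMh2 : 2 ≤ Mh) (a : Fin (d + 1) → ℤ) {M ρ k n R : ℕ} (hn : 1 ≤ n) (hnk : n ≤ k)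
    (hρd : Mh * (ℓ + 1) ∣ ρ) (hMd : Mh * (ℓ + 1) ∣ M) (hρ0 : 0 < ρ) (hR : R * (Mh * (ℓ + 1)) ≤ ρ)
    {η : ℝ} (w aw : ℕ → ℝ)
    (hw : ∀ j, j ≤ n → w j * (((((ℓ + 1 : ℕ) : ℝ) ^ (d + 1))⁻¹) ^ j) ^ 2 = (η ^ 2)⁻¹ * levC d ℓ aw j)
    (K : (Fin (d + 1) → ℤ) → (Fin (d + 1) → ℤ) → ℝ)
    (hK : ∀ x z, K x z = ((η ^ 2)⁻¹ * ∑ μ : Fin (d + 1), ((2 : ℝ) * (if z = x then (1 : ℝ) else 0) - (if z = x + e μ then (1 : ℝ) else 0)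
        - (if z = x - e μ then (1 : ℝ) else 0))) +
        (∑ j ∈ Finset.range (n + 1), (if blockMap ((ℓ + 1) ^ j) x ∈ cubeLamS (ℓ + 1) a M ρ k n j ∧
            blockMap ((ℓ + 1) ^ j) z = blockMap ((ℓ + 1) ^ j) x then
          w j * (((((ℓ + 1 : ℕ) : ℝ) ^ (d + 1))⁻¹) ^ j) ^ 2 else 0)))
    (S : Finset (Fin (d + 1) → ℤ)) (hS : ∀ z, z ∈ S ↔ z ∈ cubeFam false (ℓ + 1) a M ρ k 0)
    (T : Matrix ↥S ↥S ℝ) (hT : T = Matrix.of (fun x z : ↥S => K x.1 z.1))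
    (f : ↥S → ℝ) (fh : ↥(boxDom (N0 ℓ Mh n (boxP ℓ M ρ k n))) → ℝ)
    (hfh : ∀ y : ↥(boxDom (N0 ℓ Mh n (boxP ℓ M ρ k n))),
      fh y = if h : y.1 - shift ℓ Mh a ρ k n ∈ S then f ⟨y.1 - shift ℓ Mh a ρ k n, h⟩ else 0)
    (x : ↥S) (hxe : ∀ μ, x.1 + e μ ∈ cube (ℓ + 1) a M ρ k 0 ∧ x.1 - e μ ∈ cube (ℓ + 1) a M ρ k 0)
    (y : ↥(boxDom (N0 ℓ Mh n (boxP ℓ M ρ k n)))) (hyx : y.1 = x.1 + shift ℓ Mh a ρ k n) :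
    (T *ᵥ f) x = (η ^ 2)⁻¹ * (mlOp (N0 ℓ Mh n (boxP ℓ M ρ k n)) ℓ n (levL0 ℓ Mh a M ρ k n) aw *ᵥ fh) y := by
  have h00 : cube (ℓ + 1) a M ρ k 0 = cubeFam false (ℓ + 1) a M ρ k 0 := (cubeFam_false_of_le _ a M ρ (Nat.zero_le k)).symm
  have hx0 : x.1 ∈ cube (ℓ + 1) a M ρ k 0 := by rw [h00]; exact (hS x.1).mp x.2
  -- the zero extension of `f`
  set g : (Fin (d + 1) → ℤ) → ℝ := fun z => if h : z ∈ S then f ⟨z, h⟩ else 0 with hg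
  have hTf : (T *ᵥ f) x = ∑ z ∈ S, K x.1 z * g z := by
    rw [Matrix.mulVec, dotProduct, ← Finset.sum_coe_sort S]
    refine Finset.sum_congr rfl fun z _ => ?_
    rw [hT, Matrix.of_apply, hg]
    simp only [dif_pos z.2]
  rw [hTf, row_eq_mlOp_row hℓ hMh hMh2 a hn hnk hρd hMd hρ0 hR w aw hw K hK S hS y hyx hx0 hxe g, Matrix.mulVec, dotProduct]
  congr 1
  refine Finset.sum_congr rfl fun y' _ => ?_
  rw [hfh y']

open Classical in
/-- **`(T(Tf))(x) = η⁻⁴·(Δ′_a(Δ′_a f̂))(x + t)`** at every `x ∈ □₀` whose `2`-ball lies in `□₀` (G0 `good_of_K_ne_zero`: every site in the support of the row `K(x,·)` has its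
neighbours in `□₀`, so the inner product transfers site by site; the outer row transfers by §2). [cite: Balaban1985RegularSpaces, (1.91) p.91; Balaban1984PropagatorsII, (2.13)–(2.14) p.225; Balaban1985BackgroundPropagators, (3.48) p.398] -/
theorem mulVec_mulVec_transfer {ℓ Mh : ℕ} (hℓ : 1 ≤ ℓ) (hMh : 1 ≤ Mh) (hMh2 : 2 ≤ Mh) (a : Fin (d + 1) → ℤ) {M ρ k n R : ℕ} (hn : 1 ≤ n) (hnk : n ≤ k)
    (hρd : Mh * (ℓ + 1) ∣ ρ) (hMd : Mh * (ℓ + 1) ∣ M) (hρ0 : 0 < ρ) (hR : R * (Mh * (ℓ + 1)) ≤ ρ)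
    {η : ℝ} (w aw : ℕ → ℝ)
    (hw : ∀ j, j ≤ n → w j * (((((ℓ + 1 : ℕ) : ℝ) ^ (d + 1))⁻¹) ^ j) ^ 2 = (η ^ 2)⁻¹ * levC d ℓ aw j)
    (K : (Fin (d + 1) → ℤ) → (Fin (d + 1) → ℤ) → ℝ)
    (hK : ∀ x z, K x z = ((η ^ 2)⁻¹ * ∑ μ : Fin (d + 1), ((2 : ℝ) * (if z = x then (1 : ℝ) else 0) - (if z = x + e μ then (1 : ℝ) else 0)
        - (if z = x - e μ then (1 : ℝ) else 0))) +
        (∑ j ∈ Finset.range (n + 1), (if blockMap ((ℓ + 1) ^ j) x ∈ cubeLamS (ℓ + 1) a M ρ k n j ∧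
            blockMap ((ℓ + 1) ^ j) z = blockMap ((ℓ + 1) ^ j) x then
          w j * (((((ℓ + 1 : ℕ) : ℝ) ^ (d + 1))⁻¹) ^ j) ^ 2 else 0)))
    (S : Finset (Fin (d + 1) → ℤ)) (hS : ∀ z, z ∈ S ↔ z ∈ cubeFam false (ℓ + 1) a M ρ k 0)
    (T : Matrix ↥S ↥S ℝ) (hT : T = Matrix.of (fun x z : ↥S => K x.1 z.1))
    (f : ↥S → ℝ) (fh : ↥(boxDom (N0 ℓ Mh n (boxP ℓ M ρ k n))) → ℝ)
    (hfh : ∀ y : ↥(boxDom (N0 ℓ Mh n (boxP ℓ M ρ k n))),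
      fh y = if h : y.1 - shift ℓ Mh a ρ k n ∈ S then f ⟨y.1 - shift ℓ Mh a ρ k n, h⟩ else 0)
    (x : ↥S) (hx2 : ∀ τ : Fin (d + 1) → ℤ, (∀ i, |τ i| ≤ 2) → x.1 + τ ∈ cube (ℓ + 1) a M ρ k 0)
    (y : ↥(boxDom (N0 ℓ Mh n (boxP ℓ M ρ k n)))) (hyx : y.1 = x.1 + shift ℓ Mh a ρ k n) :
    (T *ᵥ (T *ᵥ f)) x = ((η ^ 2)⁻¹) ^ 2 *
      (mlOp (N0 ℓ Mh n (boxP ℓ M ρ k n)) ℓ n (levL0 ℓ Mh a M ρ k n) aw *ᵥ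
        (mlOp (N0 ℓ Mh n (boxP ℓ M ρ k n)) ℓ n (levL0 ℓ Mh a M ρ k n) aw *ᵥ fh)) y := by
  have hL : 1 ≤ ℓ + 1 := Nat.succ_pos ℓ
  have hρL : ℓ + 1 ≤ ρ := le_trans (Nat.le_mul_of_pos_left _ hMh) (Nat.le_of_dvd hρ0 hρd)
  have h00 : cube (ℓ + 1) a M ρ k 0 = cubeFam false (ℓ + 1) a M ρ k 0 := (cubeFam_false_of_le _ a M ρ (Nat.zero_le k)).symm
  have hx0 : x.1 ∈ cube (ℓ + 1) a M ρ k 0 := by rw [h00]; exact (hS x.1).mp x.2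
  set t := shift ℓ Mh a ρ k n with ht
  have hxe : ∀ μ, x.1 + e μ ∈ cube (ℓ + 1) a M ρ k 0 ∧ x.1 - e μ ∈ cube (ℓ + 1) a M ρ k 0 := fun μ =>
    ⟨hx2 (e μ) (fun i => (abs_e_apply_le μ i).trans (by norm_num)), by
      rw [sub_eq_add_neg]
      exact hx2 (-e μ) (fun i => by rw [Pi.neg_apply, abs_neg]; exact (abs_e_apply_le μ i).trans (by norm_num))⟩
  -- a row of `T` as a sum over the finite set `S`
  have hTrow : ∀ (v : ↥S → ℝ) (x' : ↥S), (T *ᵥ v) x' = ∑ z : ↥S, K x'.1 z.1 * v z := fun v x' => by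
    simp only [hT, Matrix.mulVec, dotProduct, Matrix.of_apply]
  -- the inner products, transported on the support of the row `K(x, ·)`
  set g₂ : (Fin (d + 1) → ℤ) → ℝ := fun w' =>
    if h : w' + t ∈ boxDom (N0 ℓ Mh n (boxP ℓ M ρ k n)) then
      (η ^ 2)⁻¹ * (mlOp (N0 ℓ Mh n (boxP ℓ M ρ k n)) ℓ n (levL0 ℓ Mh a M ρ k n) aw *ᵥ fh) ⟨w' + t, h⟩ else 0 with hg₂
  have hinner : ∀ z : ↥S, K x.1 z.1 ≠ 0 → (T *ᵥ f) z = g₂ z.1 := by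
    intro z hz
    obtain ⟨hz0, hze⟩ := good_of_K_ne_zero hL a M hρL hn hnk w K (by simpa using hK) hx2 hz
    have hzt : z.1 + t ∈ boxDom (N0 ℓ Mh n (boxP ℓ M ρ k n)) := mem_boxDom_of_mem_cube_zero hℓ hMh2 a hn hnk hz0
    have hval : g₂ z.1 = (η ^ 2)⁻¹ * (mlOp (N0 ℓ Mh n (boxP ℓ M ρ k n)) ℓ n (levL0 ℓ Mh a M ρ k n) aw *ᵥ fh) ⟨z.1 + t, hzt⟩ := by
      simp only [hg₂, dif_pos hzt]
    rw [hval]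
    exact mulVec_transfer hℓ hMh hMh2 a hn hnk hρd hMd hρ0 hR w aw hw K hK S hS T hT f fh hfh z hze ⟨z.1 + t, hzt⟩ rfl
  have h1 : (T *ᵥ (T *ᵥ f)) x = ∑ z ∈ S, K x.1 z * g₂ z := by
    rw [hTrow, ← Finset.sum_coe_sort S]
    refine Finset.sum_congr rfl fun z _ => ?_
    by_cases hz : K x.1 z.1 = 0
    · rw [hz, zero_mul, zero_mul]
    · rw [hinner z hz]
  rw [h1, row_eq_mlOp_row hℓ hMh hMh2 a hn hnk hρd hMd hρ0 hR w aw hw K hK S hS y hyx hx0 hxe g₂]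
  -- unfold the transported inner products: `g₂(y′ − t) = η⁻²(Δ′_a f̂)(y′)`
  have hg₂y : ∀ y' : ↥(boxDom (N0 ℓ Mh n (boxP ℓ M ρ k n))),
      g₂ (y'.1 - t) = (η ^ 2)⁻¹ * (mlOp (N0 ℓ Mh n (boxP ℓ M ρ k n)) ℓ n (levL0 ℓ Mh a M ρ k n) aw *ᵥ fh) y' := by
    intro y'
    have hmem : y'.1 - t + t ∈ boxDom (N0 ℓ Mh n (boxP ℓ M ρ k n)) := by rw [sub_add_cancel]; exact y'.2
    have hy' : (⟨y'.1 - t + t, hmem⟩ : ↥(boxDom (N0 ℓ Mh n (boxP ℓ M ρ k n)))) = y' := Subtype.ext (sub_add_cancel _ _)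
    simp only [hg₂, dif_pos hmem, hy']
  have hsum : (∑ y' : ↥(boxDom (N0 ℓ Mh n (boxP ℓ M ρ k n))),
        mlOp (N0 ℓ Mh n (boxP ℓ M ρ k n)) ℓ n (levL0 ℓ Mh a M ρ k n) aw y y' * g₂ (y'.1 - t))
      = ∑ y' : ↥(boxDom (N0 ℓ Mh n (boxP ℓ M ρ k n))), mlOp (N0 ℓ Mh n (boxP ℓ M ρ k n)) ℓ n (levL0 ℓ Mh a M ρ k n) aw y y' *
          ((η ^ 2)⁻¹ * (mlOp (N0 ℓ Mh n (boxP ℓ M ρ k n)) ℓ n (levL0 ℓ Mh a M ρ k n) aw *ᵥ fh) y') :=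
    Finset.sum_congr rfl fun y' _ => by rw [hg₂y y']
  rw [hsum, show (mlOp (N0 ℓ Mh n (boxP ℓ M ρ k n)) ℓ n (levL0 ℓ Mh a M ρ k n) aw *ᵥ
      (mlOp (N0 ℓ Mh n (boxP ℓ M ρ k n)) ℓ n (levL0 ℓ Mh a M ρ k n) aw *ᵥ fh)) y
      = ∑ y' : ↥(boxDom (N0 ℓ Mh n (boxP ℓ M ρ k n))), mlOp (N0 ℓ Mh n (boxP ℓ M ρ k n)) ℓ n (levL0 ℓ Mh a M ρ k n) aw y y' *
          (mlOp (N0 ℓ Mh n (boxP ℓ M ρ k n)) ℓ n (levL0 ℓ Mh a M ρ k n) aw *ᵥ fh) y' from rfl,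
    Finset.mul_sum, Finset.mul_sum]
  refine Finset.sum_congr rfl fun y' _ => ?_
  ring

end Literature.MathematicalPhysics.QuantumFieldTheory.Balaban1983to89.B8CubeMemberBoxRowsL0
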